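import Mathlib
import Summits.KontsevichZagierPeriods.KontsevichZagierPeriods.Theses.InverseLandau
import Literature.NumberTheory.Transcendental.KZCalculus
import Literature.NumberTheory.Transcendental.KZLogCalculusProofs
import Literature.NumberTheory.Transcendental.KZSemialgebraicComplex
import Literature.NumberTheory.Transcendental.SemialgebraicMapsProofs
import Literature.NumberTheory.Transcendental.KZBetaChains
import Literature.NumberTheory.Transcendental.KZDominatedFamilyRelations
import Summits.KontsevichZagierPeriods.KontsevichZagierPeriods.Theorems.HermiteRigidityGenusTwoCycleTransferPushforwardDimOne
import Summits.KontsevichZagierPeriods.KontsevichZagierPeriods.Theorems.OctahedralSymmetryOctahedralInvolutionMove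
import Summits.KontsevichZagierPeriods.KontsevichZagierPeriods.Theorems.HyperbolicBlochOffTetraSectorKernelStubPutnam

/-!
# `TateLifting` (stmt-KontsevichZagierPeriods-9129), line `Sketch` — stub `stub_croftonEllipse`:
# Cauchy–Crofton for the ellipse inside the Kontsevich–Zagier rules

Item `CroftonEllipse` (stmt-KontsevichZagierPeriods-5397, route KinematicFormulas, verbatim): for
rational semi-axes `a, b > 0` and the ellipse `E = {b²q₀² + a²q₁² ≤ a²b²}`, in tan-half-angle
coordinates (`u ↦ n(u) = ((1 − u²)/(1 + u²), 2u/(1 + u²))`, `dθ = 2du/(1 + u²)`) the line-hit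
representation `r = [S, 2/(1 + y₀²)]` over
`S = {(y₀, y₁) | 0 ≤ y₁ ∧ ∃ q ∈ E, (1 − y₀²)q₀ + 2y₀q₁ = (1 + y₀²)y₁} ⊆ ℝ²` (lines at signed
distance `y₁` in direction `n(y₀)` meeting `E`) and the arc-length representation
`r' = [ℝ, 2√(4a²s² + b²(1 − s²)²)/(1 + s²)²]` of the perimeter of `E` over the rational
parametrisation `s ↦ (a(1 − s²)/(1 + s²), 2bs/(1 + s²))` satisfy `[r] − [r'] ∈ KZ.relations`
(`tateLifting_croftonEllipse`). Three moves and two null points: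

* **The heart (support function of the ellipse).** `(1 − y₀²)q₀ + 2y₀q₁ = (1 + y₀²)⟨n(y₀), q⟩`, and a
  linear functional `(α, β)` takes on `E` exactly the values `c` with `c² ≤ a²α² + b²β²`
  (`exists_iff_sq_le`: Cauchy–Schwarz `a²b²(αq₀ + βq₁)² ≤ (a²α² + b²β²)(b²q₀² + a²q₁²)`, the
  difference being `(a²αq₁ − b²βq₀)²`, for `⇒`; the maximiser `c·(a²α, b²β)/(a²α² + b²β²)` for `⇐`).
  Hence `S` IS the closed band `{0 ≤ y₁ ≤ h(y₀)}` under the `ℚ`-semialgebraic support function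
  `h(s) = √(a²(1 − s²)² + 4b²s²)/(1 + s²)` (`mem_lineHit_iff`, `isSemialgebraicFunOn_edge`).
* **Rule (3)** along `y₁` over the base `ℝ`, edges `0 ≤ h`, primitive `F = 2y₁/(1 + y₀²)`
  (`band_sub_base_mem`): `[S, 2/(1 + y₀²)] − B ∈ newtonLeibnizRel` for the support-function one-form
  `B = [ℝ, 2√(a²(1 − s²)² + 4b²s²)/(1 + s²)²]`, absolutely integrable by comparison with
  `2√(a² + b²)/(1 + s²)` (`exists_baseRep`).
* **Rule (2), the Möbius quarter-turn.** `B` carries the SUPPORT-FUNCTION one-form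
  `√(a²n₀² + b²n₁²) dθ`, the item the SPEED one-form `√(a²n₁² + b²n₀²) dθ` of the rational
  parametrisation; the rotation `θ ↦ π/2 − θ` exchanging them is, in `t = tan(θ/2)`, the `ℚ`-rational
  involution `Φ(t) = (1 − t)/(1 + t)` of `ℝ ∖ {−1}` (`Φ' = −2/(1 + t)²`, `1 + Φ² = 2(1 + t²)/(1 + t)²`,
  KEY IDENTITY `4a²Φ² + b²(1 − Φ²)² = (a²(1 − t²)² + 4b²t²)·(2/(1 + t)²)²`, `quartic_moebius`), so
  `f(t) = g(Φ t)·|Φ'(t)|` for the two integrands and `[ℝ ∖ {−1}, f] − [ℝ ∖ {−1}, g] ∈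
  changeOfVariablesRel` (`base_sub_speed_mem`); the pole is null on both sides (rule (1),
  `KZ.IntegralRep.of_sub_of_restrict_mem_relations`).

No definition is introduced; integrability of `r`, `r'` is carried by their fields. The involution
algebra of `Φ` (`cay_cay`, `hasDerivAt_cay`, `abs_cayDeriv`, `putnam_one_add`) is imported from
`Theorems/OctahedralSymmetryOctahedralInvolutionMove.lean` (Zhao's `σ`) and
`Theorems/HyperbolicBlochOffTetraSectorKernelStubPutnam.lean`; pattern of
`Theorems/InverseLandauTateLiftingRealPeriodSwap.lean` and `…MinkowskiBinaryAccessible.lean`.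
References: M. Kontsevich, D. Zagier, *Periods* (2001), §1.1 (perimeter of an ellipse), §1.2 rules
(1)–(3); L. A. Santaló, *Integral Geometry and Geometric Probability* (2004), §I.3 (Cauchy–Crofton);
J. Bochnak, M. Coste, M.-F. Roy, *Real Algebraic Geometry* (1998), §2.2.
-/

noncomputable section

open MeasureTheory Set
open Literature.NumberTheory.Transcendental
open Literature.ModelTheory.ExponentialFields (IsSemialgebraic isSemialgebraic_univ
  isSemialgebraic_setOf_eval_ne_zero)
open MvPolynomial (X C aeval)
open Summit.KontsevichZagierPeriods.HermiteRigidity.GenusTwoCycleTransfer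
  (det_smul_id_fin_one hasFDerivAt_fin_one)
open Summit.KontsevichZagierPeriods.OctahedralSymmetry.OctahedralInvolutionMove
  (cay_cay hasDerivAt_cay abs_cayDeriv)
open Summit.KontsevichZagierPeriods.HyperbolicBloch.OffTetraSectorKernel (putnam_one_add)

namespace Summit.KontsevichZagierPeriods.InverseLandau

namespace CroftonEllipse

/-! ### The support function of the ellipse -/

/-- **Support function of the ellipse.** For `a, b > 0` the linear functional `(α, β)` takes on the
ellipse `E = {b²q₀² + a²q₁² ≤ a²b²}` exactly the values `c` with `c² ≤ a²α² + b²β²`: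
`⇒` is Cauchy–Schwarz in the form `a²b²(αq₀ + βq₁)² ≤ (a²α² + b²β²)(b²q₀² + a²q₁²)`
(the difference is `(a²αq₁ − b²βq₀)²`), `⇐` is the explicit point `c·(a²α, b²β)/(a²α² + b²β²) ∈ E`.
[cite: SantaloKac2004, §I.3] -/
theorem exists_iff_sq_le {a b : ℝ} (ha : 0 < a) (hb : 0 < b) {α β c : ℝ}
    (hD : 0 < a ^ 2 * α ^ 2 + b ^ 2 * β ^ 2) :
    (∃ q : Fin 2 → ℝ, b ^ 2 * q 0 ^ 2 + a ^ 2 * q 1 ^ 2 ≤ a ^ 2 * b ^ 2 ∧ α * q 0 + β * q 1 = c) ↔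
      c ^ 2 ≤ a ^ 2 * α ^ 2 + b ^ 2 * β ^ 2 := by
  have hab : 0 < a ^ 2 * b ^ 2 := by positivity
  constructor
  · rintro ⟨q, hq, rfl⟩
    have key : a ^ 2 * b ^ 2 * (α * q 0 + β * q 1) ^ 2 ≤
        (a ^ 2 * α ^ 2 + b ^ 2 * β ^ 2) * (b ^ 2 * q 0 ^ 2 + a ^ 2 * q 1 ^ 2) := by
      nlinarith [sq_nonneg (a ^ 2 * α * q 1 - b ^ 2 * β * q 0)]
    have h2 := mul_le_mul_of_nonneg_left hq hD.le
    nlinarith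
  · intro hc
    have hD0 : a ^ 2 * α ^ 2 + b ^ 2 * β ^ 2 ≠ 0 := hD.ne'
    refine ⟨![c * (a ^ 2 * α) / (a ^ 2 * α ^ 2 + b ^ 2 * β ^ 2),
      c * (b ^ 2 * β) / (a ^ 2 * α ^ 2 + b ^ 2 * β ^ 2)], ?_, ?_⟩
    · have h1 : b ^ 2 * (c * (a ^ 2 * α) / (a ^ 2 * α ^ 2 + b ^ 2 * β ^ 2)) ^ 2 +
          a ^ 2 * (c * (b ^ 2 * β) / (a ^ 2 * α ^ 2 + b ^ 2 * β ^ 2)) ^ 2 =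
          a ^ 2 * b ^ 2 * c ^ 2 / (a ^ 2 * α ^ 2 + b ^ 2 * β ^ 2) := by
        field_simp
      simp only [Matrix.cons_val_zero, Matrix.cons_val_one, Matrix.cons_val_fin_one]
      rw [h1, div_le_iff₀ hD]
      nlinarith [mul_le_mul_of_nonneg_left hc hab.le]
    · simp only [Matrix.cons_val_zero, Matrix.cons_val_one, Matrix.cons_val_fin_one]
      rw [mul_div_assoc', mul_div_assoc', ← add_div, div_eq_iff hD0]
      ring

/-- The support quartic `a²(1 − s²)² + 4b²s²` (`= (1 + s²)²·h(s)²`) is positive for `a, b > 0`.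
[folklore] -/
theorem quartic_pos {a b : ℝ} (ha : 0 < a) (hb : 0 < b) (s : ℝ) :
    0 < a ^ 2 * (1 - s ^ 2) ^ 2 + 4 * b ^ 2 * s ^ 2 := by
  rcases eq_or_ne s 0 with rfl | hs
  · have h : 0 < a ^ 2 := by positivity
    simpa using h
  · have h1 : 0 < 4 * b ^ 2 * s ^ 2 := by positivity
    have h2 : 0 ≤ a ^ 2 * (1 - s ^ 2) ^ 2 := by positivity
    linarith

/-- **The line-hit set is the support-function band.** The fibre of
`S = {0 ≤ p ∧ ∃ q ∈ E, (1 − s²)q₀ + 2sq₁ = (1 + s²)p}` over the direction parameter `s` is the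
interval `0 ≤ p ≤ h(s) = √(a²(1 − s²)² + 4b²s²)/(1 + s²)` (`exists_iff_sq_le` with
`(α, β) = (1 − s², 2s)`, `c = (1 + s²)p`). [cite: SantaloKac2004, §I.3] -/
theorem mem_lineHit_iff {a b : ℝ} (ha : 0 < a) (hb : 0 < b) (s p : ℝ) :
    (0 ≤ p ∧ ∃ q : Fin 2 → ℝ, b ^ 2 * q 0 ^ 2 + a ^ 2 * q 1 ^ 2 ≤ a ^ 2 * b ^ 2 ∧
      (1 - s ^ 2) * q 0 + 2 * s * q 1 = (1 + s ^ 2) * p) ↔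
    0 ≤ p ∧ p ≤ √(a ^ 2 * (1 - s ^ 2) ^ 2 + 4 * b ^ 2 * s ^ 2) / (1 + s ^ 2) := by
  have hD := quartic_pos ha hb s
  have hP : 0 < 1 + s ^ 2 := by positivity
  have e : a ^ 2 * (1 - s ^ 2) ^ 2 + b ^ 2 * (2 * s) ^ 2 =
      a ^ 2 * (1 - s ^ 2) ^ 2 + 4 * b ^ 2 * s ^ 2 := by ring
  refine and_congr_right fun hp => ?_
  rw [exists_iff_sq_le ha hb (by rw [e]; exact hD), e, le_div_iff₀ hP,
    Real.le_sqrt (by positivity) hD.le, mul_comm]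

/-! ### The support-function band and its Newton–Leibniz descent -/

/-- The support-function edge `h(s) = √(a²(1 − s²)² + 4b²s²)/(1 + s²)` is a `ℚ`-semialgebraic
function on `ℝ¹` (square root of a `ℚ`-polynomial over a non-vanishing `ℚ`-polynomial).
[cite: BochnakCosteRoy1998, Prop. 2.2.6] -/
theorem isSemialgebraicFunOn_edge (a b : ℚ) :
    IsSemialgebraicFunOn ℚ (univ : Set (Fin 1 → ℝ))
      (fun x => √((a : ℝ) ^ 2 * (1 - x 0 ^ 2) ^ 2 + 4 * (b : ℝ) ^ 2 * x 0 ^ 2) / (1 + x 0 ^ 2)) := by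
  have hs : IsSemialgebraic ℚ (univ : Set (Fin 1 → ℝ)) := isSemialgebraic_univ
  refine ((IsSemialgebraicFunOn.sqrt_holds (isSemialgebraicFunOn_aeval hs
    (C a ^ 2 * (1 - X 0 ^ 2) ^ 2 + 4 * C b ^ 2 * X 0 ^ 2 : MvPolynomial (Fin 1) ℚ))).div
    (isSemialgebraicFunOn_aeval hs (1 + X 0 ^ 2 : MvPolynomial (Fin 1) ℚ)) fun x _ => ?_).congr
    fun x _ => ?_
  · have h : (0 : ℝ) < 1 + x 0 ^ 2 := by positivity
    simpa using h.ne'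
  · simp

/-- **The base representation** `B = [ℝ, 2√(a²(1 − s²)² + 4b²s²)/(1 + s²)²]` (`= [ℝ, 2h(s)/(1 + s²)]`,
the support-function one-form of the ellipse) exists: the integrand is `ℚ`-semialgebraic on `ℝ¹`
and absolutely integrable, being continuous and bounded by `2√(a² + b²)/(1 + s²)`
(`a²(1 − s²)² + 4b²s² ≤ (a² + b²)(1 + s²)²`). [cite: KontsevichZagier2001, §1.1] -/
theorem exists_baseRep (a b : ℚ) : ∃ B : KZ.IntegralRep 1, B.domain = univ ∧
    B.integrand = fun x => 2 * √((a : ℝ) ^ 2 * (1 - x 0 ^ 2) ^ 2 + 4 * (b : ℝ) ^ 2 * x 0 ^ 2) /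
      (1 + x 0 ^ 2) ^ 2 := by
  have hs : IsSemialgebraic ℚ (univ : Set (Fin 1 → ℝ)) := isSemialgebraic_univ
  have hsa : IsSemialgebraicFunOn ℚ (univ : Set (Fin 1 → ℝ)) fun x =>
      2 * √((a : ℝ) ^ 2 * (1 - x 0 ^ 2) ^ 2 + 4 * (b : ℝ) ^ 2 * x 0 ^ 2) / (1 + x 0 ^ 2) ^ 2 := by
    refine ((IsSemialgebraicFunOn.mul_holds (isSemialgebraicFunOn_aeval hs (2 : MvPolynomial (Fin 1) ℚ))
      (IsSemialgebraicFunOn.sqrt_holds (isSemialgebraicFunOn_aeval hs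
        (C a ^ 2 * (1 - X 0 ^ 2) ^ 2 + 4 * C b ^ 2 * X 0 ^ 2 : MvPolynomial (Fin 1) ℚ)))).div
      (isSemialgebraicFunOn_aeval hs ((1 + X 0 ^ 2) ^ 2 : MvPolynomial (Fin 1) ℚ)) fun x _ => ?_).congr
      fun x _ => ?_
    · have h : (0 : ℝ) < (1 + x 0 ^ 2) ^ 2 := by positivity
      simpa using h.ne'
    · simp
  have hint : IntegrableOn (fun x : Fin 1 → ℝ =>
      2 * √((a : ℝ) ^ 2 * (1 - x 0 ^ 2) ^ 2 + 4 * (b : ℝ) ^ 2 * x 0 ^ 2) / (1 + x 0 ^ 2) ^ 2) univ := by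
    have h := (KZ.integrableOn_setOf_apply_mem_iff
      (g := fun t : ℝ => 2 * √((a : ℝ) ^ 2 * (1 - t ^ 2) ^ 2 + 4 * (b : ℝ) ^ 2 * t ^ 2) / (1 + t ^ 2) ^ 2)
      (S := univ)).2 ?_
    · simpa using h
    · rw [integrableOn_univ]
      have hK : (0 : ℝ) ≤ (a : ℝ) ^ 2 + (b : ℝ) ^ 2 := by positivity
      refine Integrable.mono' (integrable_inv_one_add_sq.const_mul (2 * √((a : ℝ) ^ 2 + (b : ℝ) ^ 2)))
        (Continuous.aestronglyMeasurable ?_) (ae_of_all _ fun t => ?_)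
      · exact Continuous.div (by fun_prop) (by fun_prop) fun t => by positivity
      · have hsq : √((a : ℝ) ^ 2 * (1 - t ^ 2) ^ 2 + 4 * (b : ℝ) ^ 2 * t ^ 2) ≤
            √((a : ℝ) ^ 2 + (b : ℝ) ^ 2) * (1 + t ^ 2) := by
          rw [Real.sqrt_le_iff]
          refine ⟨by positivity, ?_⟩
          rw [mul_pow, Real.sq_sqrt hK]
          nlinarith [mul_nonneg (sq_nonneg (a : ℝ)) (sq_nonneg t),
            mul_nonneg (sq_nonneg (b : ℝ)) (sq_nonneg (1 - t ^ 2))]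
        rw [Real.norm_eq_abs, abs_of_nonneg (by positivity)]
        calc 2 * √((a : ℝ) ^ 2 * (1 - t ^ 2) ^ 2 + 4 * (b : ℝ) ^ 2 * t ^ 2) / (1 + t ^ 2) ^ 2
            ≤ 2 * (√((a : ℝ) ^ 2 + (b : ℝ) ^ 2) * (1 + t ^ 2)) / (1 + t ^ 2) ^ 2 := by gcongr
          _ = 2 * √((a : ℝ) ^ 2 + (b : ℝ) ^ 2) * (1 + t ^ 2)⁻¹ := by
            field_simp
  exact ⟨⟨univ, _, hs, hsa, hint⟩, rfl, rfl⟩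

/-- **The Newton–Leibniz move** (rule (3)) along the last coordinate `y₁` over the base `ℝ¹`, with
edges `0 ≤ e` (`e` a non-negative `ℚ`-semialgebraic function) and primitive `F = 2y₁/(1 + y₀²)`:
for a band representation `r = [{0 ≤ y₁ ≤ e(y₀)}, f]` with `f = 2/(1 + y₀²)` on the band and a base
representation `B = [ℝ, 2e(s)/(1 + s²)]` (`= F(s, e s) − F(s, 0)`), `[r] − [B] ∈ KZ.relations`.
[cite: KontsevichZagier2001, §1.2 rule (3)] -/
theorem band_sub_base_mem (r : KZ.IntegralRep 2) (B : KZ.IntegralRep 1) {e : (Fin 1 → ℝ) → ℝ}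
    (he : IsSemialgebraicFunOn ℚ B.domain e) (he0 : ∀ x, 0 ≤ e x) (hBd : B.domain = univ)
    (hrd : r.domain = {z : Fin 2 → ℝ | 0 ≤ z 1 ∧ z 1 ≤ e (Fin.init z)})
    (hri : EqOn r.integrand (fun y => 2 / (1 + y 0 ^ 2)) r.domain)
    (hBi : ∀ x, B.integrand x = 2 * e x / (1 + x 0 ^ 2)) :
    KZ.of r - KZ.of B ∈ KZ.relations := by
  have hFs : ∀ (x : Fin 1 → ℝ) (t : ℝ),
      (fun z : Fin 2 → ℝ => 2 * z 1 / (1 + z 0 ^ 2)) (Fin.snoc x t) = 2 * t / (1 + x 0 ^ 2) :=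
    fun x t => by simp [Fin.snoc]
  have hs0 : ∀ (x : Fin 1 → ℝ) (t : ℝ), (Fin.snoc x t : Fin 2 → ℝ) 0 = x 0 :=
    fun x t => by simp [Fin.snoc]
  have hs1 : ∀ (x : Fin 1 → ℝ) (t : ℝ), (Fin.snoc x t : Fin 2 → ℝ) 1 = t :=
    fun x t => by simp [Fin.snoc]
  have hdom : r.domain = {z : Fin 2 → ℝ | (Fin.init z : Fin 1 → ℝ) ∈ B.domain ∧
      (fun _ : Fin 1 → ℝ => (0 : ℝ)) (Fin.init z) ≤ z (Fin.last 1) ∧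
        z (Fin.last 1) ≤ e (Fin.init z)} := by
    rw [hrd, hBd]
    ext z
    simp only [mem_setOf_eq, mem_univ, true_and]
    exact Iff.rfl
  refine KZ.newtonLeibnizRel_subset_relations ⟨1, r, B, fun _ => 0, e,
    fun z => 2 * z 1 / (1 + z 0 ^ 2), ?_, ?_, he, fun x _ => he0 x, hdom, fun x _ => ?_,
    fun x _ t ht => ?_, fun x _ => ?_, rfl⟩
  · refine (isSemialgebraicFunOn_aeval_div_aeval r.isSemialgebraic_domain
      (2 * X 1 : MvPolynomial (Fin 2) ℚ) (1 + X 0 ^ 2) fun z _ => ?_).congr fun z _ => by simp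
    have h : (0 : ℝ) < 1 + z 0 ^ 2 := by positivity
    simpa using h.ne'
  · exact (isSemialgebraicFunOn_aeval B.isSemialgebraic_domain (0 : MvPolynomial (Fin 1) ℚ)).congr
      fun _ _ => by simp
  · simp only [hFs]
    fun_prop
  · -- its derivative on the open fibre is the integrand of `r`
    have hmem : (Fin.snoc x t : Fin 2 → ℝ) ∈ r.domain := by
      rw [hrd]
      simp only [mem_setOf_eq, hs1, Fin.init_snoc]
      exact ⟨ht.1.le, ht.2.le⟩
    have hft : r.integrand (Fin.snoc x t) = 2 / (1 + x 0 ^ 2) := by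
      rw [hri hmem]
      simp only [hs0]
    simp only [hFs, hft]
    simpa using ((hasDerivAt_id t).const_mul (2 : ℝ)).div_const (1 + x 0 ^ 2)
  · rw [hBi, hFs, hFs]
    ring

/-! ### The Möbius quarter-turn `Φ(t) = (1 − t)/(1 + t)`

`Φ` is Zhao's involution `σ` of `Theorems/OctahedralSymmetryOctahedralInvolutionMove.lean`
(`cay_cay : Φ (Φ t) = t`, `hasDerivAt_cay : Φ' = −2/(1 + t)²`); here it is the quarter-turn
`θ ↦ π/2 − θ` read in `t = tan(θ/2)`. -/

/-- `Φ` misses the pole: `1 + Φ t = 2/(1 + t) ≠ 0`. [folklore] -/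
theorem one_add_moebius_ne {t : ℝ} (ht : 1 + t ≠ 0) : 1 + (1 - t) / (1 + t) ≠ 0 := by
  rw [putnam_one_add ht]
  positivity

/-- `1 + Φ² = (1 + t²)·(2/(1 + t)²)` (the conformal factor of the quarter-turn). [folklore] -/
theorem one_add_moebius_sq {t : ℝ} (ht : 1 + t ≠ 0) :
    1 + ((1 - t) / (1 + t)) ^ 2 = (1 + t ^ 2) * (2 / (1 + t) ^ 2) := by
  field_simp
  ring

/-- **The key identity**: the speed quartic at `Φ t` is the support quartic at `t` times `Φ'(t)²`,
`4a²Φ² + b²(1 − Φ²)² = (a²(1 − t²)² + 4b²t²)·(2/(1 + t)²)²` (from `2Φ/(1 + Φ²) = (1 − t²)/(1 + t²)`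
and `(1 − Φ²)/(1 + Φ²) = 2t/(1 + t²)`: the quarter-turn swaps `n₀ ↔ n₁`). [folklore] -/
theorem quartic_moebius (a b : ℝ) {t : ℝ} (ht : 1 + t ≠ 0) :
    4 * a ^ 2 * ((1 - t) / (1 + t)) ^ 2 + b ^ 2 * (1 - ((1 - t) / (1 + t)) ^ 2) ^ 2 =
      (a ^ 2 * (1 - t ^ 2) ^ 2 + 4 * b ^ 2 * t ^ 2) * (2 / (1 + t) ^ 2) ^ 2 := by
  field_simp
  ring

/-- The image identity `Φ '' (ℝ ∖ {−1}) = ℝ ∖ {−1}` on `ℝ¹` (`Φ` is an involution of the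
complement of its pole). [folklore] -/
theorem image_moebius :
    (fun x : Fin 1 → ℝ => fun _ : Fin 1 => (1 - x 0) / (1 + x 0)) '' {x | 1 + x 0 ≠ 0} =
      {x | 1 + x 0 ≠ 0} := by
  ext y
  constructor
  · rintro ⟨x, hx, rfl⟩
    exact one_add_moebius_ne hx
  · intro hy
    refine ⟨fun _ => (1 - y 0) / (1 + y 0), one_add_moebius_ne hy, ?_⟩
    funext i
    obtain rfl : i = 0 := Fin.fin_one_eq_zero i
    exact cay_cay hy

/-- The complement `{1 + t ≠ 0} ⊆ ℝ¹` of the pole is `ℚ`-semialgebraic and co-null (the pole is the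
hyperplane `{t = −1}` of `ℝ¹`). [folklore] -/
theorem pole :
    IsSemialgebraic ℚ {x : Fin 1 → ℝ | 1 + x 0 ≠ 0} ∧
      volume ((univ : Set (Fin 1 → ℝ)) \ {x | 1 + x 0 ≠ 0}) = 0 := by
  refine ⟨?_, measure_mono_null (fun x hx => ?_) (KZ.volume_setOf_last_eq_zero (n := 0) (-1))⟩
  · convert isSemialgebraic_setOf_eval_ne_zero (k := ℚ) (R := ℝ)
      (1 + X 0 : MvPolynomial (Fin 1) ℚ) using 1
    ext x
    simp
  · have h : 1 + x 0 = 0 := not_not.1 hx.2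
    show x 0 = -1
    linarith

/-- **The Möbius quarter-turn** (rule (2) between two null-point removals, rule (1)): the
support-function one-form `B = [ℝ, f]`, `f(t) = 2√(a²(1 − t²)² + 4b²t²)/(1 + t²)²`, and the speed
one-form `r' = [ℝ, g]`, `g(s) = 2√(4a²s² + b²(1 − s²)²)/(1 + s²)²`, of the ellipse satisfy
`[B] − [r'] ∈ KZ.relations`: off the null pole `{−1}`, `Φ(t) = (1 − t)/(1 + t)` is a `ℚ`-rational
injective self-map of `ℝ ∖ {−1}` onto itself (`cay_cay`) with `Φ' = −2/(1 + t)²` (`hasDerivAt_cay`)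
and `f(t) = g(Φ t)·|Φ'(t)|` (`quartic_moebius`, `one_add_moebius_sq`).
[cite: KontsevichZagier2001, §1.2 rule (2)] -/
theorem base_sub_speed_mem (a b : ℚ) (B r' : KZ.IntegralRep 1) (hBd : B.domain = univ)
    (hBi : B.integrand = fun x => 2 * √((a : ℝ) ^ 2 * (1 - x 0 ^ 2) ^ 2 + 4 * (b : ℝ) ^ 2 * x 0 ^ 2) /
      (1 + x 0 ^ 2) ^ 2)
    (hr'd : r'.domain = univ)
    (hr'i : EqOn r'.integrand (fun s => 2 * Real.sqrt (4 * (a : ℝ) ^ 2 * s 0 ^ 2 +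
      (b : ℝ) ^ 2 * (1 - s 0 ^ 2) ^ 2) / (1 + s 0 ^ 2) ^ 2) r'.domain) :
    KZ.of B - KZ.of r' ∈ KZ.relations := by
  obtain ⟨hU, hnull⟩ := pole
  have hBU : {x : Fin 1 → ℝ | 1 + x 0 ≠ 0} ⊆ B.domain := by rw [hBd]; exact subset_univ _
  have hr'U : {x : Fin 1 → ℝ | 1 + x 0 ≠ 0} ⊆ r'.domain := by rw [hr'd]; exact subset_univ _
  have h₁ := KZ.IntegralRep.of_sub_of_restrict_mem_relations B hU hBU (by rw [hBd]; exact hnull)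
  have h₃ := KZ.IntegralRep.of_sub_of_restrict_mem_relations r' hU hr'U (by rw [hr'd]; exact hnull)
  have h₂ : KZ.of (B.restrict _ hU hBU) - KZ.of (r'.restrict _ hU hr'U) ∈ KZ.relations := by
    refine KZ.changeOfVariablesRel_subset_relations
      ⟨1, B.restrict _ hU hBU, r'.restrict _ hU hr'U, fun x _ => (1 - x 0) / (1 + x 0),
        fun x => (-2 / (1 + x 0) ^ 2) • ContinuousLinearMap.id ℝ (Fin 1 → ℝ), ?_,
        fun x hx => (hasFDerivAt_fin_one _ _ x (hasDerivAt_cay hx)).hasFDerivWithinAt,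
        fun x hx y hy hxy => ?_, (image_moebius).symm, fun x hx => ?_, rfl⟩
    · -- a `ℚ`-rational map off the pole
      refine IsSemialgebraicMapOn.of_forall hU fun _ => ?_
      have hq : ∀ x ∈ {x : Fin 1 → ℝ | 1 + x 0 ≠ 0}, aeval x (1 + X 0 : MvPolynomial (Fin 1) ℚ) ≠ 0 :=
        fun x hx => by simpa using hx
      exact (isSemialgebraicFunOn_aeval_div_aeval hU (1 - X 0 : MvPolynomial (Fin 1) ℚ) (1 + X 0)
        hq).congr fun x _ => by simp
    · -- injectivity: `Φ` is an involution
      have h0 : (1 - x 0) / (1 + x 0) = (1 - y 0) / (1 + y 0) := congrFun hxy 0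
      funext i
      obtain rfl : i = 0 := Fin.fin_one_eq_zero i
      rw [← cay_cay (u := x 0) hx, h0, cay_cay (u := y 0) hy]
    · -- the Jacobian identity `f(t) = g(Φ t)·|Φ'(t)|`
      have ht : 1 + x 0 ≠ 0 := hx
      have hc : 0 < 2 / (1 + x 0) ^ 2 := by positivity
      have hD : 0 ≤ (a : ℝ) ^ 2 * (1 - x 0 ^ 2) ^ 2 + 4 * (b : ℝ) ^ 2 * x 0 ^ 2 := by positivity
      have hΦ : (fun _ : Fin 1 => (1 - x 0) / (1 + x 0)) ∈ r'.domain := hr'd ▸ mem_univ _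
      have e1 : B.integrand x =
          2 * √((a : ℝ) ^ 2 * (1 - x 0 ^ 2) ^ 2 + 4 * (b : ℝ) ^ 2 * x 0 ^ 2) / (1 + x 0 ^ 2) ^ 2 := by
        rw [hBi]
      have e2 : r'.integrand (fun _ : Fin 1 => (1 - x 0) / (1 + x 0)) =
          2 * √(4 * (a : ℝ) ^ 2 * ((1 - x 0) / (1 + x 0)) ^ 2 +
            (b : ℝ) ^ 2 * (1 - ((1 - x 0) / (1 + x 0)) ^ 2) ^ 2) /
            (1 + ((1 - x 0) / (1 + x 0)) ^ 2) ^ 2 := hr'i hΦ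
      show B.integrand x = r'.integrand (fun _ : Fin 1 => (1 - x 0) / (1 + x 0)) *
        |((-2 / (1 + x 0) ^ 2) • ContinuousLinearMap.id ℝ (Fin 1 → ℝ)).det|
      rw [e1, e2, det_smul_id_fin_one, abs_cayDeriv, quartic_moebius _ _ ht,
        one_add_moebius_sq ht, Real.sqrt_mul hD, Real.sqrt_sq hc.le]
      field_simp
  convert sub_mem (add_mem h₁ h₂) h₃ using 1
  abel

end CroftonEllipse

open CroftonEllipse in
/-- **CAUCHY–CROFTON FOR THE ELLIPSE INSIDE THE RULES** (stub `stub_croftonEllipse` of line `Sketch`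
for crux `TateLifting`; item `CroftonEllipse`, stmt-KontsevichZagierPeriods-5397, route
KinematicFormulas, verbatim): for rational `a, b > 0`, the tan-half-angle line-hit representation
`[{(y₀, y₁) | 0 ≤ y₁, ∃ q ∈ E, (1 − y₀²)q₀ + 2y₀q₁ = (1 + y₀²)y₁}, 2/(1 + y₀²)]` of the measure of lines
meeting the ellipse `E = {b²q₀² + a²q₁² ≤ a²b²}` and the arc-length representation
`[ℝ, 2√(4a²s² + b²(1 − s²)²)/(1 + s²)²]` of its perimeter differ by a KZ relation: the line-hit set is
the closed band under the support function `h(s) = √(a²(1 − s²)² + 4b²s²)/(1 + s²)`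
(`mem_lineHit_iff`), one Newton–Leibniz move along `y₁` descends it to the support-function one-form
`[ℝ, 2h(s)/(1 + s²)]` (`band_sub_base_mem`), and the Möbius quarter-turn `t ↦ (1 − t)/(1 + t)`
(one change of variables off the null pole `−1`) exchanges the support-function and speed one-forms
of the ellipse (`base_sub_speed_mem`). [cite: KontsevichZagier2001, §1.2] -/
theorem tateLifting_croftonEllipse :
    ∀ a b : ℚ, 0 < a → 0 < b → ∀ (r : KZ.IntegralRep 2) (r' : KZ.IntegralRep 1), r.domain = {y : Fin 2 → ℝ | 0 ≤ y 1 ∧ ∃ q : Fin 2 → ℝ, (b : ℝ) ^ 2 * q 0 ^ 2 + (a : ℝ) ^ 2 * q 1 ^ 2 ≤ (a : ℝ) ^ 2 * (b : ℝ) ^ 2 ∧ (1 - y 0 ^ 2) * q 0 + 2 * y 0 * q 1 = (1 + y 0 ^ 2) * y 1} → Set.EqOn r.integrand (fun y => 2 / (1 + y 0 ^ 2)) r.domain → r'.domain = Set.univ → Set.EqOn r'.integrand (fun s => 2 * Real.sqrt (4 * (a : ℝ) ^ 2 * s 0 ^ 2 + (b : ℝ) ^ 2 * (1 - s 0 ^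 2) ^ 2) / (1 + s 0 ^ 2) ^ 2) r'.domain → KZ.of r - KZ.of r' ∈ KZ.relations := by
  intro a b ha hb r r' hrd hri hr'd hr'i
  have ha' : (0 : ℝ) < a := by exact_mod_cast ha
  have hb' : (0 : ℝ) < b := by exact_mod_cast hb
  obtain ⟨B, hBd, hBi⟩ := exists_baseRep a b
  -- the heart: the line-hit set IS the closed band under the support function
  have hband : r.domain = {z : Fin 2 → ℝ | 0 ≤ z 1 ∧ z 1 ≤
      (fun x : Fin 1 → ℝ => √((a : ℝ) ^ 2 * (1 - x 0 ^ 2) ^ 2 + 4 * (b : ℝ) ^ 2 * x 0 ^ 2) /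
        (1 + x 0 ^ 2)) (Fin.init z)} := by
    rw [hrd]
    ext y
    exact mem_lineHit_iff ha' hb' (y 0) (y 1)
  -- rule (3) along `y₁`, then the quarter-turn (rule (2)) with its two null points (rule (1))
  have h₁ : KZ.of r - KZ.of B ∈ KZ.relations :=
    band_sub_base_mem r B (hBd ▸ isSemialgebraicFunOn_edge a b) (fun x => by positivity) hBd hband hri
      fun x => by simp only [hBi]; rw [mul_div_assoc', div_div, ← pow_two]
  have h₂ := base_sub_speed_mem a b B r' hBd hBi hr'd hr'i
  have h := add_mem h₁ h₂
  rwa [sub_add_sub_cancel] at h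

end Summit.KontsevichZagierPeriods.InverseLandau

end
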